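/-
Copyright (c) 2026. All rights reserved.
Released under Apache 2.0 license as described in the file LICENSE.
Authors: abc-iut cell, prover seat abc-iut-w4-d017 (wave 4, gen 5).
-/
import Literature.IUT.LogVolume.UnitLogDyadicNoFixedBall
import Literature.IUT.LogVolume.UnitLogBallTorsionCensusDyadic
import Literature.IUT.LogVolume.UnitLogWildQuadraticDyadicCases
import HarnessLib

/-!
# Dyadic fields containing `√−1`: `log₂(𝒪_K^×)` is a multiple of a ball iff `(e, f) = (2, 1)` — and then it is `𝔪³`

Proof-only file (theorems, no definitions).  Classical `2`-adic analysis (Neukirch, *Algebraic Number Theory*,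
Ch. II (5.5), (5.7)); nothing here is disputed mathematics and no IUT statement is asserted.

For a complete ultrametric normed `ℚ₂`-algebra field `K` (uniformizer `ϖ`, invariants `e`, `f`, `2^m = #μ_{2^∞}(K)`):

* §1 `closedBall_ne_zpow_smul_logUnits_of_zpow_le_norm` — the GAP LEMMA of `UnitLogDyadicNoFixedBall` sharpened
  (any `p`): a unit logarithm `z` with `‖ϖ‖^{j₁} ≤ ‖z‖` and `f·(j₁ − 1) < m` rules out `{‖y‖ ≤ ‖ϖ‖^j} =
  p^k·log_p(𝒪_K^×)` for all `j`, `k` (abc-iut-w5-d039's volume identity `m = f·(j − k·e − 1)`);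
* §2 `p = 2`, **`e = 4`, `m ≥ 2`** ⇒ NO ball is a `2^k·log₂(𝒪_K^×)` (abc-iut-w5-d039's `‖log₂(1 − ϖ³)‖ = ‖ϖ‖²` at
  `e = 4` is the witness `j₁ = 2` when `f = 1`; `f ≥ 2` is `UnitLogDyadicNoFixedBall`);
* §3 **`K ∋ i` with `i² = −1`** (so `e ≥ 2`, `m ≥ 2` — abc-iut-w5-d039): NO ball is a `2^k·log₂(𝒪_K^×)` unless
  `(e, f) = (2, 1)` (`closedBall_ne_zpow_smul_logUnits_of_sq_eq_neg_one`), and if `(e, f) = (2, 1)` (`K ≅ ℚ₂(√−1)`)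
  then `log₂(𝒪_K^×) = 𝔪³ = {‖y‖ ≤ ‖ϖ‖³}` (`logUnits_eq_closedBall_cube_of_sq_eq_neg_one`, this seat's
  `UnitLogWildQuadraticDyadicCases` at `a = −1`), so that exactly the balls `𝔪^j`, `j` odd, are `2^k·log₂(𝒪_K^×)`.

Every base field of an initial Θ-datum contains `√−1` ([IUTchI] Def. 3.1 (a)), so §3 describes ALL dyadic places of
such fields.  Consumer: the abc-iut cell's TEAM R «ismDH mover» thread (`Thm311RealIsmDHMoverCriterion`).
[cite: NeukirchANT1999, Ch. II Prop. (5.5), (5.7)]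
-/

noncomputable section

open Metric Set
open scoped Pointwise

namespace Literature.IUT.LogVolume

namespace DyadicNoFixedBall

open RamificationCriterion Literature.NumberTheory.GaloisRepresentations.Ultrametric

/-! ## 1. The sharpened gap lemma (any `p`) -/

section Gap

variable (p : ℕ) [hp : Fact p.Prime] {K : Type*} [NontriviallyNormedField K] [NormedAlgebra ℚ_[p] K]
  [IsUltrametricDist K] [ProperSpace K]

/-- **SHARPENED GAP LEMMA.** A unit logarithm `z ∈ log_p(𝒪_K^×)` with `‖ϖ‖^{j₁} ≤ ‖z‖` (valuation `≤ j₁`) and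
`f·(j₁ − 1) < m` rules out `{‖y‖ ≤ ‖ϖ‖^j} = p^k·log_p(𝒪_K^×)` for every `j`, `k` (volume: `m = f·(j − k·e − 1)`,
while `p^k·z` in the ball gives `j − k·e ≤ j₁`). [cite: NeukirchANT1999, Ch. II Prop. (5.7)] -/
theorem closedBall_ne_zpow_smul_logUnits_of_zpow_le_norm {ϖ : Kˣ} (hϖ : IsUniformizer ϖ) {z : K}
    (hz : z ∈ logUnits K) {j₁ : ℤ} (hzn : ‖(ϖ : K)‖ ^ j₁ ≤ ‖z‖)
    (hlt : (residueDegree p K : ℤ) * (j₁ - 1) < torsionPExp p K) (j k : ℤ) :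
    closedBall (0 : K) (‖(ϖ : K)‖ ^ j) ≠ ((p : ℚ_[p]) ^ k) • logUnits K := by
  intro h
  have H := torsionPExp_eq_of_closedBall_eq_zpow_smul_logUnits p K hϖ h
  have hρ0 : 0 < ‖(ϖ : K)‖ := norm_units_pos ϖ
  have hmem : ((p : ℚ_[p]) ^ k) • z ∈ closedBall (0 : K) (‖(ϖ : K)‖ ^ j) := h ▸ smul_mem_smul_set hz
  rw [mem_closedBall_zero_iff, norm_smul, Padic.norm_p_zpow, natCast_prime_eq_zpow p hϖ, ← zpow_mul,
    show -(absRamificationIdx p K : ℤ) * -k = k * (absRamificationIdx p K : ℤ) by ring] at hmem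
  have h1 : ‖(ϖ : K)‖ ^ (k * (absRamificationIdx p K : ℤ) + j₁) ≤ ‖(ϖ : K)‖ ^ j := by
    rw [zpow_add₀ hρ0.ne']
    exact (mul_le_mul_of_nonneg_left hzn (zpow_pos hρ0 _).le).trans hmem
  have hj : j ≤ k * (absRamificationIdx p K : ℤ) + j₁ := (zpow_le_zpow_iff_right_of_lt_one₀ hρ0 hϖ.1).mp h1
  have hf : (0 : ℤ) ≤ residueDegree p K := by positivity
  have hle : (residueDegree p K : ℤ) * (j - k * (absRamificationIdx p K : ℤ) - 1) ≤
      (residueDegree p K : ℤ) * (j₁ - 1) := mul_le_mul_of_nonneg_left (by linarith) hf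
  linarith

end Gap

/-! ## 2. `p = 2`, `e = 4`, `m ≥ 2`: no ball -/

section Dyadic

variable {K : Type*} [NontriviallyNormedField K] [NormedAlgebra ℚ_[2] K] [IsUltrametricDist K] [ProperSpace K]
  {ϖ : Kˣ} (hϖ : IsUniformizer ϖ)

include hϖ

/-- **`p = 2`, `e = 4`, `m ≥ 2` ⇒ `{‖y‖ ≤ ‖ϖ‖^j} ≠ 2^k·log₂(𝒪_K^×)` for all `j`, `k`** (`f ≥ 2`: a unit with a unit
logarithm; `f = 1`: `‖log₂(1 − ϖ³)‖ = ‖ϖ‖²` with `f·(2 − 1) = 1 < m`). [cite: NeukirchANT1999, Ch. II Prop. (5.5), (5.7)] -/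
theorem closedBall_ne_zpow_smul_logUnits_of_absRamificationIdx_eq_four (he : absRamificationIdx 2 K = 4)
    (hm : 2 ≤ torsionPExp 2 K) (j k : ℤ) :
    closedBall (0 : K) (‖(ϖ : K)‖ ^ j) ≠ ((2 : ℚ_[2]) ^ k) • logUnits K := by
  by_cases hf : 2 ≤ residueDegree 2 K
  · exact closedBall_ne_zpow_smul_logUnits_of_two_dvd hϖ (by rw [he]; norm_num) hf j k
  · have hf1 : residueDegree 2 K = 1 := by have := residueDegree_pos 2 K; omega
    have hP : IsPrincipal (1 - (ϖ : K) ^ 3) := isPrincipal_one_sub_pow hϖ (by norm_num)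
    have hz := norm_unitLog_one_sub_cube_of_absRamificationIdx_eq_four 2 K rfl he hϖ
    have h := closedBall_ne_zpow_smul_logUnits_of_zpow_le_norm 2 hϖ (unitLog_mem_logUnits hP.norm_eq_one)
      (j₁ := 2) hz.ge (by rw [hf1]; push_cast; omega) j k
    simpa only [Nat.cast_ofNat] using h

/-- **THE DYADIC TABLE with `m ≥ 2`**: at `p = 2` with `e ≥ 2` and `m ≥ 2`, unless `(e, f) = (2, 1)`, NO ball
`{‖y‖ ≤ ‖ϖ‖^j}` is a `2^k·log₂(𝒪_K^×)`. [cite: NeukirchANT1999, Ch. II Prop. (5.5), (5.7)] -/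
theorem closedBall_ne_zpow_smul_logUnits_of_two_le_torsionPExp (he2 : 2 ≤ absRamificationIdx 2 K)
    (hm : 2 ≤ torsionPExp 2 K) (hnot : ¬ (absRamificationIdx 2 K = 2 ∧ residueDegree 2 K = 1)) (j k : ℤ) :
    closedBall (0 : K) (‖(ϖ : K)‖ ^ j) ≠ ((2 : ℚ_[2]) ^ k) • logUnits K := by
  by_cases he4 : absRamificationIdx 2 K = 4
  · exact closedBall_ne_zpow_smul_logUnits_of_absRamificationIdx_eq_four hϖ he4 hm j k
  · refine closedBall_ne_zpow_smul_logUnits_dyadic hϖ he2 ?_ j k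
    rintro ⟨hf1, he | he⟩
    · exact hnot ⟨he, hf1⟩
    · exact he4 he

/-! ## 3. `K ∋ √−1` -/

/-- **`K ∋ i`, `i² = −1`, `(e, f) ≠ (2, 1)` ⇒ `{‖y‖ ≤ ‖ϖ‖^j} ≠ 2^k·log₂(𝒪_K^×)` for all `j`, `k`** (`i` forces
`e ≥ 2` and `m ≥ 2`, abc-iut-w5-d039). [cite: NeukirchANT1999, Ch. II Prop. (5.5), (5.7)] -/
theorem closedBall_ne_zpow_smul_logUnits_of_sq_eq_neg_one {i : K} (hi : i ^ 2 = -1)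
    (hnot : ¬ (absRamificationIdx 2 K = 2 ∧ residueDegree 2 K = 1)) (j k : ℤ) :
    closedBall (0 : K) (‖(ϖ : K)‖ ^ j) ≠ ((2 : ℚ_[2]) ^ k) • logUnits K :=
  closedBall_ne_zpow_smul_logUnits_of_two_le_torsionPExp hϖ
    (two_le_absRamificationIdx_two_of_sq_eq_neg_one 2 K rfl hi) (two_le_torsionPExp_of_sq_eq_neg_one 2 K rfl hi)
    hnot j k

/-- Norm form: `K ∋ √−1`, `(e, f) ≠ (2, 1)`, `t ≠ 0` ⇒ `{‖y‖ ≤ ‖t‖} ≠ 2^k·log₂(𝒪_K^×)`.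
[cite: NeukirchANT1999, Ch. II Prop. (5.5), (5.7)] -/
theorem closedBall_norm_ne_zpow_smul_logUnits_of_sq_eq_neg_one {i : K} (hi : i ^ 2 = -1)
    (hnot : ¬ (absRamificationIdx 2 K = 2 ∧ residueDegree 2 K = 1)) {t : K} (ht : t ≠ 0) (k : ℤ) :
    closedBall (0 : K) ‖t‖ ≠ ((2 : ℚ_[2]) ^ k) • logUnits K := by
  obtain ⟨j, hj⟩ := hϖ.2 (Units.mk0 t ht)
  rw [Units.val_mk0] at hj
  rw [hj]
  exact closedBall_ne_zpow_smul_logUnits_of_sq_eq_neg_one hϖ hi hnot j k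

/-- **`K ∋ i`, `i² = −1`, `(e, f) = (2, 1)` (`K ≅ ℚ₂(√−1)`) ⇒ `log₂(𝒪_K^×) = 𝔪³ = {‖y‖ ≤ ‖ϖ‖³}`** (this seat's
`WildQuadraticDyadic.logUnits_eq_closedBall_cube_of_sq_eq` at `a = −1`: `‖1 − a‖ = 1/2`, `‖1 + a‖ = 0`).
[cite: NeukirchANT1999, Ch. II Prop. (5.5)] -/
theorem logUnits_eq_closedBall_cube_of_sq_eq_neg_one [CompleteSpace K] {i : K} (hi : i ^ 2 = -1)
    (he : absRamificationIdx 2 K = 2) (hf : residueDegree 2 K = 1) :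
    logUnits K = closedBall (0 : K) (‖(ϖ : K)‖ ^ 3) := by
  have hsq : i ^ 2 = algebraMap ℚ_[2] K (-1) := by rw [hi, map_neg, map_one]
  have ha1 : ‖(1 : ℚ_[2]) - (-1)‖ = 2⁻¹ := by
    rw [sub_neg_eq_add, show (1 : ℚ_[2]) + 1 = 2 by norm_num, WildDyadic.norm_two]
  have ha2 : ‖(1 : ℚ_[2]) + (-1)‖ ≤ 8⁻¹ := by norm_num
  exact WildQuadraticDyadic.logUnits_eq_closedBall_cube_of_sq_eq hϖ he hf hsq ha1 ha2

end Dyadic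

end DyadicNoFixedBall

end Literature.IUT.LogVolume

end
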